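import Summits.AnomalousDissipation.AnomalousDissipation.Theses.MomentParity
import Summits.AnomalousDissipation.AnomalousDissipation.Theorems.MomentParityGalerkinEnsembleRealization
import Summits.AnomalousDissipation.AnomalousDissipation.Theorems.ResolvedDissipation.Negative.KillShape
import Summits.AnomalousDissipation.AnomalousDissipation.Theorems.MomentParityResolvedDissipationInvariance

/-!
# Stub S2a `stub_levelWorkMean` of line `lh-energy-equality-bracket`
# (crux `MomentParity.ResolvedDissipation`, stmt-AnomalousDissipation-14284)

The mean WORK of the level law is the ensemble's `∫ (u, f) dμ`. For a level-`N` Galerkin-invariant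
ensemble `μ` (a probability law on `H = Torus.energySpace (Fin 3)`, band-limited to `freqBall N`,
carried by the ball `‖u‖ ≤ R`, annihilating the Navier–Stokes generator on band-limited cylindrical
tests) and its push-forward `P = (orbitPathOn)_* (u ↦ 𝓕u|_{freqBall N})_* μ` to the compact
trajectory space `𝒦 = pathSpace R (pathLip ν A R)`, the `P`-mean of the window-`[0,1]` work
functional `W(ω) = ∫₀¹ Σ'_k Re⟪𝓕f k, ω̄(t,k)⟫_ℂ dt` equals `∫ (u, f) dμ`.

Twin of the landed `stub_levelDissMean` (Theorems/MomentParityGalerkinEnsembleRealizationStubLevelDissMean):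
(i) Fubini on `[0,1] × 𝒦` — the integrand `(t, ω) ↦ Σ'_k Re⟪𝓕f k, ω̄(t,k)⟫` is jointly continuous
(`continuous_pathExt_subtype_prod`, `Σ_k ‖𝓕f k‖ < ∞` for smooth `f`, `continuous_tsum`) and bounded by
`(Σ_k ‖𝓕f k‖)·|R|` (`norm_pathExt_le`); (ii) at a fixed time `t ≥ 0`, through the orbit map on the
good set (`pathExt_orbitPath`), the integrand is the finite sum
`c ↦ Σ_{k ∈ freqBall N} Re⟪𝓕f k, (φ_t c)‾ k⟫`, and invariance of the law of the coefficients under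
the Galerkin semiflow (`map_coeff_invariant`) removes the flow; (iii) Parseval
(`hasSum_re_inner_mFourierCoeff_complexify`) on the band-limited fields of the ensemble identifies
`Σ_{k ∈ freqBall N} Re⟪𝓕f k, 𝓕u k⟫` with `(u, f) = ∫ ⟪u, f⟫`. Source: Foias–Rosa–Temam 2013
(arXiv:1111.6257), proof of Thm 3.1; Foias–Manley–Rosa–Temam 2001, Ch. IV App. B.
-/

noncomputable section

set_option linter.dupNamespace false

namespace Summit.AnomalousDissipation.AnomalousDissipation.Theorems.MomentParityResolvedDissipation.LhBracket.LevelWorkMean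

open MeasureTheory Filter Topology Set Function Metric UnitAddTorus
open scoped ENNReal InnerProductSpace RealInnerProductSpace BigOperators
open Literature.Analysis.FunctionSpaces Literature.Analysis.FunctionSpaces.Torus
open Literature.Analysis.FluidPDE Literature.Analysis.FluidPDE.Torus
open Summit.AnomalousDissipation.AnomalousDissipation.Theses.MomentParity
open Summit.AnomalousDissipation.AnomalousDissipation.Theorems.MomentParity
open Summit.AnomalousDissipation.AnomalousDissipation.Theorems.QuarticGate.Negative
  (IsLevel IsBandTest polyGrad IsPolyStationary)
open Summit.AnomalousDissipation.AnomalousDissipation.Theorems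

/-! ### The work integrand on the trajectory space: termwise bound, continuity, Fubini -/

/-- Termwise bound on the trajectory space: `|Re⟪F k, ω̄(t,k)⟫| ≤ ‖F k‖ · |R|` for `ω ∈ 𝒦(R, L)`
(Cauchy–Schwarz and `‖ω̄(t,k)‖ ≤ |R|`). -/
private theorem norm_re_inner_pathExt_le {R : ℝ} {L : (Fin 3 → ℤ) → ℝ}
    (F : (Fin 3 → ℤ) → EuclideanSpace ℂ (Fin 3)) {ω : MomentParity.Path (Fin 3)}
    (hω : ω ∈ pathSpace R L) (t : ℝ) (k : Fin 3 → ℤ) :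
    ‖(inner ℂ (F k) (pathExt ω t k)).re‖ ≤ ‖F k‖ * |R| := by
  rw [Real.norm_eq_abs]
  exact (Complex.abs_re_le_norm _).trans ((norm_inner_le_norm _ _).trans
    (mul_le_mul_of_nonneg_left (norm_pathExt_le hω t k) (norm_nonneg _)))

/-- **Joint continuity of the work integrand** `(ω, t) ↦ Σ'_k Re⟪F k, ω̄(t,k)⟫` on `𝒦 × ℝ` when
`Σ_k ‖F k‖ < ∞` (each term is continuous, uniform summable majorant `‖F k‖ · |R|`). -/
private theorem continuous_workIntegrand {F : (Fin 3 → ℤ) → EuclideanSpace ℂ (Fin 3)}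
    (hF : Summable fun k => ‖F k‖) (R : ℝ) (L : (Fin 3 → ℤ) → ℝ) :
    Continuous fun p : ↥(pathSpace (d := Fin 3) R L) × ℝ =>
      ∑' k : Fin 3 → ℤ, (inner ℂ (F k) (pathExt p.1.1 p.2 k)).re := by
  refine continuous_tsum (fun k => ?_) (hF.mul_right |R|)
    fun k p => norm_re_inner_pathExt_le F p.1.2 p.2 k
  have h : Continuous fun p : ↥(pathSpace (d := Fin 3) R L) × ℝ =>
      inner ℂ (F k) (pathExt p.1.1 p.2 k) :=
    Continuous.inner (𝕜 := ℂ) continuous_const (continuous_pathExt_subtype_prod R L k)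
  have h2 := Complex.continuous_re.comp h
  exact h2

/-- Bound of the work integrand on the trajectory space: `|Σ'_k Re⟪F k, ω̄(t,k)⟫| ≤ (Σ_k ‖F k‖)·|R|`. -/
private theorem norm_workIntegrand_le {R : ℝ} {L : (Fin 3 → ℤ) → ℝ}
    {F : (Fin 3 → ℤ) → EuclideanSpace ℂ (Fin 3)} (hF : Summable fun k => ‖F k‖)
    {ω : MomentParity.Path (Fin 3)} (hω : ω ∈ pathSpace R L) (t : ℝ) :
    ‖∑' k : Fin 3 → ℤ, (inner ℂ (F k) (pathExt ω t k)).re‖ ≤ (∑' k, ‖F k‖) * |R| :=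
  tsum_of_norm_bounded (hF.hasSum.mul_right |R|) fun k => norm_re_inner_pathExt_le F hω t k

/-- **Fubini for the mean work**: against a finite law `P` on the trajectory space,
`∫ (∫₀¹ Σ'_k Re⟪F k, ω̄(t,k)⟫ dt) dP = ∫₀¹ (∫ Σ'_k Re⟪F k, ω̄(t,k)⟫ dP) dt` (the integrand is
jointly continuous and bounded on `ℝ × 𝒦`). -/
private theorem integral_workMean_eq_intervalIntegral {R : ℝ} {L : (Fin 3 → ℤ) → ℝ}
    (P : Measure ↥(pathSpace (d := Fin 3) R L)) [IsFiniteMeasure P]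
    {F : (Fin 3 → ℤ) → EuclideanSpace ℂ (Fin 3)} (hF : Summable fun k => ‖F k‖) :
    ∫ ω, (∫ t in (0 : ℝ)..1, ∑' k : Fin 3 → ℤ, (inner ℂ (F k) (pathExt ω.1 t k)).re) ∂P =
      ∫ t in (0 : ℝ)..1, ∫ ω, ∑' k : Fin 3 → ℤ, (inner ℂ (F k) (pathExt ω.1 t k)).re ∂P := by
  symm
  apply intervalIntegral_integral_swap
  rw [uIoc_of_le zero_le_one, Function.uncurry_def]
  have hcont : Continuous fun p : ℝ × ↥(pathSpace (d := Fin 3) R L) =>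
      ∑' k : Fin 3 → ℤ, (inner ℂ (F k) (pathExt p.2.1 p.1 k)).re := by
    have h := (continuous_workIntegrand hF R L).comp
      (continuous_swap (X := ℝ) (Y := ↥(pathSpace (d := Fin 3) R L)))
    exact h
  refine Integrable.of_bound hcont.aestronglyMeasurable ((∑' k, ‖F k‖) * |R|)
    (ae_of_all _ fun p => ?_)
  exact norm_workIntegrand_le hF p.2.2 p.1

/-! ### At a fixed time: through the orbit map, and invariance -/

/-- The work read on the phase space, `c ↦ Σ_{k ∈ freqBall N} Re⟪F k, c̄ k⟫`, is continuous. -/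
private theorem continuous_workSum (N : ℕ) (F : (Fin 3 → ℤ) → EuclideanSpace ℂ (Fin 3)) :
    Continuous fun c : ↥(freqBall (d := Fin 3) N) → EuclideanSpace ℂ (Fin 3) =>
      ∑ k ∈ freqBall N, (inner ℂ (F k) (coeffExt (freqBall N) c k)).re := by
  refine continuous_finsetSum _ fun k hk => ?_
  simp_rw [coeffExt_of_mem _ hk]
  have h : Continuous fun c : ↥(freqBall (d := Fin 3) N) → EuclideanSpace ℂ (Fin 3) =>
      inner ℂ (F k) (c ⟨k, hk⟩) :=
    Continuous.inner (𝕜 := ℂ) continuous_const (continuous_apply _)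
  have h2 := Complex.continuous_re.comp h
  exact h2

/-- The time-`t` map of the Galerkin semiflow (`t ≥ 0`) is a.e. measurable for every measure on the
phase space carried by the good set (it is continuous on the closed phase space). -/
private theorem aemeasurable_galerkinCoeffFlow_of_good {ν : ℝ} {N : ℕ}
    {g : ↥(freqBall (d := Fin 3) N) → EuclideanSpace ℂ (Fin 3)} {R : ℝ} {L : (Fin 3 → ℤ) → ℝ}
    (hν : 0 ≤ ν) (hg : IsRealCoeff g)
    {m : Measure (↥(freqBall (d := Fin 3) N) → EuclideanSpace ℂ (Fin 3))}
    (hm : m {c | c ∈ galerkinSubspace (freqBall N) ∧ orbitPath ν g c ∈ pathSpace R L}ᶜ = 0)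
    {t : ℝ} (ht : 0 ≤ t) : AEMeasurable (galerkinCoeffFlow ν g t) m := by
  have hcont : ContinuousOn (fun c => galerkinCoeffFlow ν g t c)
      ((galerkinSubspace (freqBall (d := Fin 3) N) :
          Submodule ℝ (↥(freqBall (d := Fin 3) N) → EuclideanSpace ℂ (Fin 3))) :
        Set (↥(freqBall (d := Fin 3) N) → EuclideanSpace ℂ (Fin 3))) :=
    (continuousOn_galerkinCoeffFlow hν neg_mem_freqBall_of_mem hg).comp
      (continuousOn_const.prodMk continuousOn_id) fun c hc => ⟨mem_Ici.2 ht, hc⟩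
  have hV : ∀ᵐ c ∂m, c ∈ ((galerkinSubspace (freqBall (d := Fin 3) N) :
      Submodule ℝ (↥(freqBall (d := Fin 3) N) → EuclideanSpace ℂ (Fin 3))) :
        Set (↥(freqBall (d := Fin 3) N) → EuclideanSpace ℂ (Fin 3))) := by
    have : ∀ᵐ c ∂m, c ∈ {c | c ∈ galerkinSubspace (freqBall N) ∧ orbitPath ν g c ∈ pathSpace R L} := by
      rw [ae_iff]; exact hm
    exact this.mono fun c hc => hc.1
  rw [← Measure.restrict_eq_self_of_ae_mem hV]
  exact hcont.aemeasurable (galerkinSubspace (freqBall N)).closed_of_finiteDimensional.measurableSet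

/-- **The fixed-time identity**: for a measure `m` on the phase space carried by the good set and
invariant under the time-`t` map of the Galerkin semiflow (`t ≥ 0`), the `(orbitPathOn)_* m`-mean of
the work integrand at time `t` is the `m`-mean of `c ↦ Σ_{k ∈ freqBall N} Re⟪F k, c̄ k⟫` (the
extension of an orbit path is the orbit, `pathExt_orbitPath`; the series is a finite sum since `c̄`
vanishes off the ball; then invariance). -/
private theorem integral_work_map_orbitPathOn {ν : ℝ} {N : ℕ}
    {g : ↥(freqBall (d := Fin 3) N) → EuclideanSpace ℂ (Fin 3)} {R : ℝ} {L : (Fin 3 → ℤ) → ℝ}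
    (hν : 0 ≤ ν) (hg : IsRealCoeff g) (ω₀ : ↥(pathSpace (d := Fin 3) R L))
    {m : Measure (↥(freqBall (d := Fin 3) N) → EuclideanSpace ℂ (Fin 3))}
    (hm : m {c | c ∈ galerkinSubspace (freqBall N) ∧ orbitPath ν g c ∈ pathSpace R L}ᶜ = 0)
    {F : (Fin 3 → ℤ) → EuclideanSpace ℂ (Fin 3)} (hF : Summable fun k => ‖F k‖)
    {t : ℝ} (ht : 0 ≤ t) (hinv : m.map (galerkinCoeffFlow ν g t) = m) :
    ∫ ω, ∑' k : Fin 3 → ℤ, (inner ℂ (F k) (pathExt ω.1 t k)).re ∂(m.map (orbitPathOn ν g R L ω₀)) =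
      ∫ c, ∑ k ∈ freqBall N, (inner ℂ (F k) (coeffExt (freqBall N) c k)).re ∂m := by
  have hS : ∀ k ∈ freqBall (d := Fin 3) N, -k ∈ freqBall (d := Fin 3) N := neg_mem_freqBall_of_mem
  have hcontω : Continuous fun ω : ↥(pathSpace (d := Fin 3) R L) =>
      ∑' k : Fin 3 → ℤ, (inner ℂ (F k) (pathExt ω.1 t k)).re := by
    have h := (continuous_workIntegrand hF R L).comp
      ((continuous_id (X := ↥(pathSpace (d := Fin 3) R L))).prodMk (continuous_const (y := t)))
    exact h
  rw [integral_map (aemeasurable_orbitPathOn hν hg ω₀ hm) hcontω.aestronglyMeasurable]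
  -- on the good set the integrand is the finite work sum of the orbit at time `t`
  have hgood : ∀ᵐ c ∂m,
      c ∈ {c | c ∈ galerkinSubspace (freqBall N) ∧ orbitPath ν g c ∈ pathSpace R L} := by
    rw [ae_iff]; exact hm
  have hae : (fun c => ∑' k : Fin 3 → ℤ,
      (inner ℂ (F k) (pathExt (orbitPathOn ν g R L ω₀ c : MomentParity.Path (Fin 3)) t k)).re) =ᵐ[m]
      fun c => ∑ k ∈ freqBall N,
        (inner ℂ (F k) (coeffExt (freqBall N) (galerkinCoeffFlow ν g t c) k)).re := by
    filter_upwards [hgood] with c hc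
    rw [coe_orbitPathOn_of_mem ν g R L ω₀ hc.2]
    simp only [pathExt_orbitPath hν hS hg hc.1 hc.2 ht]
    refine tsum_eq_sum fun k hk => ?_
    rw [coeffExt_of_not_mem _ hk, inner_zero_right, Complex.zero_re]
  calc ∫ c, ∑' k : Fin 3 → ℤ,
        (inner ℂ (F k) (pathExt (orbitPathOn ν g R L ω₀ c : MomentParity.Path (Fin 3)) t k)).re ∂m
      = ∫ c, ∑ k ∈ freqBall N,
          (inner ℂ (F k) (coeffExt (freqBall N) (galerkinCoeffFlow ν g t c) k)).re ∂m :=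
        integral_congr_ae hae
    _ = ∫ c, ∑ k ∈ freqBall N, (inner ℂ (F k) (coeffExt (freqBall N) c k)).re
          ∂(m.map (galerkinCoeffFlow ν g t)) :=
        (integral_map (aemeasurable_galerkinCoeffFlow_of_good hν hg hm ht)
          (continuous_workSum N F).aestronglyMeasurable).symm
    _ = ∫ c, ∑ k ∈ freqBall N, (inner ℂ (F k) (coeffExt (freqBall N) c k)).re ∂m := by rw [hinv]

/-! ### Parseval on the band-limited ensemble -/

/-- `Re⟪a, b⟫_ℂ = Re⟪b, a⟫_ℂ`. -/
private theorem re_inner_comm (a b : EuclideanSpace ℂ (Fin 3)) :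
    (inner ℂ a b).re = (inner ℂ b a).re := by
  rw [← inner_conj_symm, Complex.conj_re]

/-- **Parseval on the ensemble**: for `μ`-a.e. `u` band-limited to `freqBall N`,
`Σ_{k ∈ freqBall N} Re⟪𝓕f k, (𝓕u|_{freqBall N})‾ k⟫ = ∫ ⟪u, f⟫ = (u, f)`
(`hasSum_re_inner_mFourierCoeff_complexify`; the series is the finite sum over the ball), so the
`(𝓕|_{freqBall N})_* μ`-mean of the work sum is `∫ (u, f) dμ`. -/
private theorem integral_workSum_eq_integral_pairing {f : UnitAddTorus (Fin 3) → EuclideanSpace ℝ (Fin 3)}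
    {N : ℕ} {μ : Measure (Torus.energySpace (Fin 3))} (hf : MemLp f 2 volume)
    (h1 : ∀ᵐ u ∂μ, ∀ k ∉ (freqBall N).erase (0 : Fin 3 → ℤ),
      mFourierCoeff (EuclideanSpace.complexify ∘
        (u.1 : UnitAddTorus (Fin 3) → EuclideanSpace ℝ (Fin 3))) k = 0) :
    ∫ c, ∑ k ∈ freqBall N, (inner ℂ (mFourierCoeff (EuclideanSpace.complexify ∘ f) k)
        (coeffExt (freqBall N) c k)).re
      ∂(μ.map fun u : Torus.energySpace (Fin 3) =>
        fourierRestrict (freqBall N) (u.1 : UnitAddTorus (Fin 3) → EuclideanSpace ℝ (Fin 3))) =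
      ∫ u, Torus.pairing u.1 f ∂μ := by
  rw [integral_map (continuous_fourierRestrict_coe N).measurable.aemeasurable
    (continuous_workSum N _).aestronglyMeasurable]
  refine integral_congr_ae ?_
  filter_upwards [h1] with u hu
  -- Parseval for the `L²` field `u` against `f`
  have hP := hasSum_re_inner_mFourierCoeff_complexify (Lp.memLp u.1) hf
  have hzero : ∀ k ∉ freqBall (d := Fin 3) N,
      (inner ℂ (mFourierCoeff (EuclideanSpace.complexify ∘
          (u.1 : UnitAddTorus (Fin 3) → EuclideanSpace ℝ (Fin 3))) k)
        (mFourierCoeff (EuclideanSpace.complexify ∘ f) k)).re = 0 := by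
    intro k hk
    rw [hu k fun h => hk (Finset.mem_of_mem_erase h), inner_zero_left, Complex.zero_re]
  rw [Torus.pairing, ← hP.tsum_eq, tsum_eq_sum hzero]
  refine Finset.sum_congr rfl fun k hk => ?_
  rw [coeffExt_of_mem _ hk, fourierRestrict_apply]
  exact re_inner_comm _ _

/-! ### The stub -/

/-- **S2a · `stub_levelWorkMean` — the mean WORK of the level law is the ensemble's `∫ (u, f) dμ`.**
Twin of the landed `stub_levelDissMean` (same hypotheses, same push-forward
`P = (orbitPathOn)_* (𝓕|_N)_* μ` on the trajectory space `𝒦 = pathSpace R (pathLip ν A R)`): the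
`P`-mean of the window-`[0,1]` work functional `ω ↦ ∫₀¹ Σ'_k Re⟪𝓕f k, ω̄(t,k)⟫ dt` equals
`∫ (u, f) dμ`. Fubini on `[0,1] × 𝒦`, the fixed-time identity through the orbit map with invariance
of the law of the coefficients under the Galerkin semiflow, and Parseval on the band-limited ensemble
(Foias–Rosa–Temam 2013, arXiv:1111.6257, proof of Thm 3.1; FMRT 2001, Ch. IV App. B). -/
theorem stub_levelWorkMean :
    ∀ (ν : ℝ), 0 < ν → ∀ (f : UnitAddTorus (Fin 3) → EuclideanSpace ℝ (Fin 3)), Torus.IsSmooth f →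
      Torus.HasZeroMean f →
    ∀ (N : ℕ) (R A : ℝ),
      (∀ k, ‖coeffExt (freqBall N) (fourierRestrict (freqBall N) f) k‖ ≤ A) → 0 ≤ A →
    ∀ (ω₀ : ↥(pathSpace (d := Fin 3) R (pathLip ν A R)))
      (μ : Measure (Torus.energySpace (Fin 3))), IsProbabilityMeasure μ →
      (∀ᵐ u ∂μ, ∀ k ∉ (freqBall N).erase (0 : Fin 3 → ℤ),
        mFourierCoeff (EuclideanSpace.complexify ∘ (u.1 : UnitAddTorus (Fin 3) → EuclideanSpace ℝ (Fin 3))) k = 0) →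
      (∀ᵐ u ∂μ, ‖u‖ ≤ R) →
      (∀ Φ : CylindricalTest (Fin 3),
        (∀ i, ∀ k ∉ (freqBall N).erase (0 : Fin 3 → ℤ),
          mFourierCoeff (EuclideanSpace.complexify ∘ (Φ.g i)) k = 0) →
          Integrable (fun u => nsGeneratorPairing ν f u (Φ.grad u)) μ ∧
            ∫ u, nsGeneratorPairing ν f u (Φ.grad u) ∂μ = 0) →
    ∫ ω, (∫ t in (0 : ℝ)..1, ∑' k : Fin 3 → ℤ,
        (inner ℂ (mFourierCoeff (EuclideanSpace.complexify ∘ f) k) (pathExt ω.1 t k)).re)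
      ∂((μ.map fun u : Torus.energySpace (Fin 3) =>
          fourierRestrict (freqBall N) (u.1 : UnitAddTorus (Fin 3) → EuclideanSpace ℝ (Fin 3))).map
          (orbitPathOn ν (fourierRestrict (freqBall N) f) R (pathLip ν A R) ω₀)) =
      ∫ u, Torus.pairing u.1 f ∂μ := by
  intro ν hν f hf hf0 N R A hA hA0 ω₀ μ hμ h1 h2 h4
  have hκm : AEMeasurable (fun u : Torus.energySpace (Fin 3) =>
      fourierRestrict (freqBall N) (u.1 : UnitAddTorus (Fin 3) → EuclideanSpace ℝ (Fin 3))) μ :=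
    (continuous_fourierRestrict_coe N).measurable.aemeasurable
  haveI : IsProbabilityMeasure (μ.map fun u : Torus.energySpace (Fin 3) =>
      fourierRestrict (freqBall N) (u.1 : UnitAddTorus (Fin 3) → EuclideanSpace ℝ (Fin 3))) :=
    Measure.isProbabilityMeasure_map hκm
  have hgr : IsRealCoeff (fourierRestrict (freqBall N) f) := isRealCoeff_mFourierCoeff hf.integrable
  have hm := map_coeff_compl_good_eq_zero hν (hf.memLp 2) hf0 hA hA0 h1 h2 h4
  have hPi : AEMeasurable (orbitPathOn ν (fourierRestrict (freqBall N) f) R (pathLip ν A R) ω₀)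
      (μ.map fun u : Torus.energySpace (Fin 3) =>
        fourierRestrict (freqBall N) (u.1 : UnitAddTorus (Fin 3) → EuclideanSpace ℝ (Fin 3))) :=
    aemeasurable_orbitPathOn hν.le hgr ω₀ hm
  haveI : IsProbabilityMeasure ((μ.map fun u : Torus.energySpace (Fin 3) =>
      fourierRestrict (freqBall N) (u.1 : UnitAddTorus (Fin 3) → EuclideanSpace ℝ (Fin 3))).map
        (orbitPathOn ν (fourierRestrict (freqBall N) f) R (pathLip ν A R) ω₀)) :=
    Measure.isProbabilityMeasure_map hPi
  -- the Fourier coefficients of the smooth force are absolutely summable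
  have hF : Summable fun k : Fin 3 → ℤ => ‖mFourierCoeff (EuclideanSpace.complexify ∘ f) k‖ :=
    summable_norm_mFourierCoeff_of_isSmooth hf
  rw [integral_workMean_eq_intervalIntegral _ hF]
  rw [intervalIntegral.integral_congr (g := fun _ => ∫ u, Torus.pairing u.1 f ∂μ) ?_]
  · simp
  · intro t ht
    rw [uIcc_of_le zero_le_one] at ht
    beta_reduce
    rw [integral_work_map_orbitPathOn hν.le hgr ω₀ hm hF ht.1
      (map_coeff_invariant hν (hf.memLp 2) hf0 h1 h2 h4 ht.1)]
    exact integral_workSum_eq_integral_pairing (hf.memLp 2) h1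

end Summit.AnomalousDissipation.AnomalousDissipation.Theorems.MomentParityResolvedDissipation.LhBracket.LevelWorkMean
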